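import Mathlib
import Summits.Ventures.PercRepro2.Defs
import Summits.Ventures.PercRepro2.Graph
import Summits.Ventures.PercRepro2.Harris
import Summits.Ventures.PercRepro2.HullDefs
import Summits.Ventures.PercRepro2.LastVertex
import Summits.Ventures.PercRepro2.AvoidSameSide

/-!
# The avoidance same-side sum with deleted edges, and the edge identity (mine-1 g8; proofs/MINE1-NEST-INDUCTION.md)

`avoidSameSideDel D` is the avoidance same-side sum of the graph with the edges of `D` DELETED
(for both colours): the red cluster is computed in `closeOn ζ D`, the blue cluster in
`closeOn (blue ζ) D`.  Main results:

* `avoidSameSideDel_swap` — the colour swap `A_D(X;Y) = A_D(Y;X)`;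
* `two_mul_avoidSameSideDel` — the EDGE identity: for an edge `e ∉ D` with an endpoint `z ∈ X ∩ Y`
  and other endpoint `w`, `2 · A_D(X;Y) = A_{D∪e}(X ∪ {w}; Y) + A_{D∪e}(X; Y ∪ {w})`
  (revealing `e`: red ⇒ `w` is red-avoided too, blue ⇒ `w` is blue-avoided too; afterwards `e` is inert);
The Harris base and the induction `NEST ⟸ STEP` are in `AvoidSameSideNest.lean`.
-/

namespace Summit.Ventures.PercRepro2

namespace Hull

variable {V : Type*} {E : Type*}

/-! ## Deleted-edge colourings -/

section Del

variable [DecidableEq E]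

/-- `closeOn ω D` is `ω` with the edges of `D` closed; it is monotone in `ω`. -/
lemma closeOn_mono {ω ω' : Config E} (h : ω ≤ ω') (D : Finset E) : closeOn ω D ≤ closeOn ω' D := by
  intro e
  simp only [closeOn]
  by_cases hd : e ∈ D
  · simp [hd]
  · simpa [hd] using h e

/-- Closing an already closed edge does nothing. -/
lemma closeOn_insert_of_eq_false {ω : Config E} {e : E} (he : ω e = false) (D : Finset E) :
    closeOn ω (insert e D) = closeOn ω D := by
  funext e'
  by_cases h : e' = e
  · subst h; simp [closeOn, he]
  · simp [closeOn, h]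

/-- `closeOn (update ω e b) (insert e D) = closeOn ω (insert e D)`: a deleted edge is inert. -/
lemma closeOn_update_insert (ω : Config E) (e : E) (b : Bool) (D : Finset E) :
    closeOn (Function.update ω e b) (insert e D) = closeOn ω (insert e D) := by
  funext e'
  by_cases h : e' = e
  · subst h; simp [closeOn]
  · simp [closeOn, h]

/-- `closeOn ω (insert e D)` is `closeOn ω D` with `e` closed. -/
lemma closeOn_insert_eq_update (ω : Config E) (e : E) (D : Finset E) :
    closeOn ω (insert e D) = Function.update (closeOn ω D) e false := by
  funext e'
  by_cases h : e' = e
  · subst h; simp [closeOn]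
  · simp [closeOn, h]

/-- The blue colouring of an update. -/
lemma blue_update (ω : Config E) (e : E) (b : Bool) :
    blue (Function.update ω e b) = Function.update (blue ω) e (!b) := by
  funext e'
  by_cases h : e' = e
  · subst h; simp [blue]
  · simp [blue, h]

/-- The red cluster of `l` with the edges of `D` deleted. -/
def clusterDel (ends : E → Sym2 V) (D : Finset E) (ζ : Config E) (l : V) : Set V :=
  cluster ends (closeOn ζ D) l

/-- The blue cluster of `l` with the edges of `D` deleted. -/
def clusterDelB (ends : E → Sym2 V) (D : Finset E) (ζ : Config E) (l : V) : Set V :=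
  cluster ends (closeOn (blue ζ) D) l

/-- The avoidance event with `D` deleted. -/
def AvoidDel (ends : E → Sym2 V) (D : Finset E) (ζ : Config E) (l : V) (X Y : Set V) : Prop :=
  Disjoint (clusterDel ends D ζ l) X ∧ Disjoint (clusterDelB ends D ζ l) Y

open scoped Classical in
/-- The side sign with `D` deleted. -/
noncomputable def sideSignDel (ends : E → Sym2 V) (D : Finset E) (ζ : Config E) (l o : V) : ℤ :=
  (if o ∈ clusterDel ends D ζ l \ clusterDelB ends D ζ l then 1 else 0)
    - (if o ∈ clusterDelB ends D ζ l \ clusterDel ends D ζ l then 1 else 0)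

/-- `closeOn ω ∅ = ω`. -/
lemma closeOn_empty (ω : Config E) : closeOn ω ∅ = ω := by
  funext e; simp [closeOn]

/-- With nothing deleted the clusters are the usual ones. -/
lemma clusterDel_empty (ends : E → Sym2 V) (ζ : Config E) (l : V) :
    clusterDel ends ∅ ζ l = cluster ends ζ l := by
  simp [clusterDel, closeOn_empty]

/-- With nothing deleted the blue cluster is the usual one. -/
lemma clusterDelB_empty (ends : E → Sym2 V) (ζ : Config E) (l : V) :
    clusterDelB ends ∅ ζ l = cluster ends (blue ζ) l := by
  simp [clusterDelB, closeOn_empty]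

/-- The swap exchanges the two deleted clusters. -/
lemma clusterDel_blue (ends : E → Sym2 V) (D : Finset E) (ζ : Config E) (l : V) :
    clusterDel ends D (blue ζ) l = clusterDelB ends D ζ l := rfl

/-- The swap exchanges the two deleted clusters (blue side). -/
lemma clusterDelB_blue (ends : E → Sym2 V) (D : Finset E) (ζ : Config E) (l : V) :
    clusterDelB ends D (blue ζ) l = clusterDel ends D ζ l := by
  simp [clusterDelB, clusterDel, blue_blue]

/-- The avoidance event of the swapped colouring exchanges `X` and `Y`. -/
lemma avoidDel_blue (ends : E → Sym2 V) (D : Finset E) (ζ : Config E) (l : V) (X Y : Set V) :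
    AvoidDel ends D (blue ζ) l X Y ↔ AvoidDel ends D ζ l Y X := by
  unfold AvoidDel
  rw [clusterDel_blue, clusterDelB_blue]
  exact and_comm

/-- The side sign of the swapped colouring is the negative. -/
lemma sideSignDel_blue (ends : E → Sym2 V) (D : Finset E) (ζ : Config E) (l o : V) :
    sideSignDel ends D (blue ζ) l o = - sideSignDel ends D ζ l o := by
  unfold sideSignDel
  rw [clusterDel_blue, clusterDelB_blue]
  ring

end Del


/-! ## Cluster lemmas for one deleted edge -/

section ClusterLemmas

variable [DecidableEq E] {ends : E → Sym2 V}

/-- Changing the state of an edge whose endpoints are both outside the cluster of `l` does not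
change the cluster. -/
lemma cluster_update_eq_of_notMem {ω : Config E} {l z w : V} {e : E} (b : Bool)
    (hends : ends e = s(z, w)) (hz : z ∉ cluster ends ω l) (hw : w ∉ cluster ends ω l) :
    cluster ends (Function.update ω e b) l = cluster ends ω l := by
  refine cluster_eq_of_eqOn_touches (ends := ends) (ω := ω) (ω' := Function.update ω e b)
    (v := l) (S := cluster ends ω l) ?_ rfl
  intro e' he'
  by_cases h : e' = e
  · subst h
    rw [mem_touches_iff_of_ends hends] at he'
    exact (he'.elim hz hw).elim
  · simp [Function.update_of_ne h]

omit [DecidableEq E] in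
/-- If `e = zw` is open in `ω` and `z` is outside the cluster of `l`, so is `w`. -/
lemma notMem_cluster_of_notMem_of_edge {ω : Config E} {l z w : V} {e : E}
    (hends : ends e = s(z, w)) (he : ω e = true) (hz : z ∉ cluster ends ω l) :
    w ∉ cluster ends ω l :=
  fun hw => hz (mem_cluster_of_edge hw he (ends_swap hends))

/-- Deleting an edge with an endpoint in an avoided set keeps the cluster. -/
lemma cluster_closeOn_insert_eq {ω : Config E} {l z w : V} {e : E} {D : Finset E} {X : Set V}
    (hends : ends e = s(z, w)) (hz : z ∈ X) (hX : Disjoint (cluster ends (closeOn ω D) l) X) :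
    cluster ends (closeOn ω (insert e D)) l = cluster ends (closeOn ω D) l := by
  have hzC : z ∉ cluster ends (closeOn ω D) l := fun h => Set.disjoint_left.1 hX h hz
  rw [closeOn_insert_eq_update]
  by_cases he : closeOn ω D e = true
  · exact cluster_update_eq_of_notMem false hends hzC
      (notMem_cluster_of_notMem_of_edge hends he hzC)
  · have he' : closeOn ω D e = false := by simpa using he
    rw [← he', Function.update_eq_self]

/-- Conversely, if the cluster with the edge deleted avoids both endpoints, restoring the edge
keeps the cluster. -/
lemma cluster_closeOn_eq_of_insert {ω : Config E} {l z w : V} {e : E} {D : Finset E} {X : Set V}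
    (hends : ends e = s(z, w)) (hz : z ∈ X)
    (hX : Disjoint (cluster ends (closeOn ω (insert e D)) l) (X ∪ {w})) :
    cluster ends (closeOn ω D) l = cluster ends (closeOn ω (insert e D)) l := by
  have hzC : z ∉ cluster ends (closeOn ω (insert e D)) l :=
    fun h => Set.disjoint_left.1 hX h (Set.mem_union_left _ hz)
  have hwC : w ∉ cluster ends (closeOn ω (insert e D)) l :=
    fun h => Set.disjoint_left.1 hX h (Set.mem_union_right _ rfl)
  have hrepr : closeOn ω D = Function.update (closeOn ω (insert e D)) e (closeOn ω D e) := by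
    rw [closeOn_insert_eq_update, Function.update_idem, Function.update_eq_self]
  rw [hrepr]
  exact cluster_update_eq_of_notMem _ hends hzC hwC

end ClusterLemmas

/-! ## The deleted-edge avoidance sum -/

section Sums

variable [Fintype E] [DecidableEq E]

open scoped Classical in
/-- The avoidance same-side sum with `D` deleted. -/
noncomputable def avoidSameSideDel (ends : E → Sym2 V) (D : Finset E) (l x y : V) (X Y : Set V) :
    ℤ :=
  ∑ ζ : Config E,
    if AvoidDel ends D ζ l X Y then sideSignDel ends D ζ l x * sideSignDel ends D ζ l y else 0

/-- With nothing deleted `avoidSameSideDel` is `avoidSameSide`. -/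
theorem avoidSameSideDel_empty (ends : E → Sym2 V) (l x y : V) (X Y : Set V) :
    avoidSameSideDel ends ∅ l x y X Y = avoidSameSide ends l x y X Y := by
  classical
  unfold avoidSameSideDel avoidSameSide
  refine Finset.sum_congr rfl fun ζ _ => ?_
  have h1 : AvoidDel ends ∅ ζ l X Y ↔ Avoid ends ζ l X Y := by
    simp [AvoidDel, Avoid, clusterDel_empty, clusterDelB_empty]
  have h2 : ∀ o, sideSignDel ends ∅ ζ l o = sideSign ℤ ends ζ l o := by
    intro o
    simp [sideSignDel, sideSign, rside, bside, clusterDel_empty, clusterDelB_empty]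
  simp only [h1, h2]

/-- **Colour-swap symmetry** of the deleted-edge sum. -/
theorem avoidSameSideDel_swap (ends : E → Sym2 V) (D : Finset E) (l x y : V) (X Y : Set V) :
    avoidSameSideDel ends D l x y X Y = avoidSameSideDel ends D l x y Y X := by
  classical
  unfold avoidSameSideDel
  have hinv : Function.Involutive (blue : Config E → Config E) := fun ζ => blue_blue ζ
  rw [← hinv.bijective.sum_comp (fun ζ => if AvoidDel ends D ζ l X Y then
      sideSignDel ends D ζ l x * sideSignDel ends D ζ l y else 0)]
  refine Finset.sum_congr rfl fun ζ _ => ?_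
  simp only [avoidDel_blue, sideSignDel_blue, neg_mul_neg]

end Sums

/-! ## The edge identity -/

section Edge

variable [Fintype E] [DecidableEq E] {ends : E → Sym2 V}

open scoped Classical in
/-- The summand of `avoidSameSideDel`. -/
noncomputable def delTerm (ends : E → Sym2 V) (D : Finset E) (l x y : V) (X Y : Set V)
    (ζ : Config E) : ℤ :=
  if AvoidDel ends D ζ l X Y then sideSignDel ends D ζ l x * sideSignDel ends D ζ l y else 0

/-- `avoidSameSideDel` as a sum of summands. -/
lemma avoidSameSideDel_eq_sum (D : Finset E) (l x y : V) (X Y : Set V) :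
    avoidSameSideDel ends D l x y X Y = ∑ ζ : Config E, delTerm ends D l x y X Y ζ := rfl

omit [Fintype E] in
/-- A deleted edge is inert for the red cluster. -/
lemma clusterDel_update_insert (D : Finset E) (ζ : Config E) (l : V) (e : E) (b : Bool) :
    clusterDel ends (insert e D) (Function.update ζ e b) l = clusterDel ends (insert e D) ζ l := by
  simp [clusterDel, closeOn_update_insert]

omit [Fintype E] in
/-- A deleted edge is inert for the blue cluster. -/
lemma clusterDelB_update_insert (D : Finset E) (ζ : Config E) (l : V) (e : E) (b : Bool) :
    clusterDelB ends (insert e D) (Function.update ζ e b) l = clusterDelB ends (insert e D) ζ l := by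
  simp [clusterDelB, blue_update, closeOn_update_insert]

omit [Fintype E] in
/-- A deleted edge is inert for the summand. -/
lemma delTerm_update_insert (D : Finset E) (l x y : V) (X Y : Set V) (ζ : Config E) (e : E)
    (b : Bool) :
    delTerm ends (insert e D) l x y X Y (Function.update ζ e b) = delTerm ends (insert e D) l x y X Y ζ := by
  unfold delTerm AvoidDel sideSignDel
  rw [clusterDel_update_insert, clusterDelB_update_insert]

omit [Fintype E] in
/-- The summand under the colour swap. -/
lemma delTerm_blue (D : Finset E) (l x y : V) (X Y : Set V) (ζ : Config E) :
    delTerm ends D l x y X Y (blue ζ) = delTerm ends D l x y Y X ζ := by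
  unfold delTerm
  rw [avoidDel_blue, sideSignDel_blue, sideSignDel_blue, neg_mul_neg]

omit [Fintype E] in
/-- **Revealing a red edge at a red-avoided vertex**: for `ζ e = true`, `e = zw ∉ D`, `z ∈ X`,
the summand equals the summand with `e` deleted and `w` red-avoided. -/
lemma delTerm_of_eq_true (D : Finset E) (l x y : V) (X Y : Set V) (ζ : Config E) {e : E}
    {z w : V} (hends : ends e = s(z, w)) (hz : z ∈ X) (heD : e ∉ D) (he : ζ e = true) :
    delTerm ends D l x y X Y ζ = delTerm ends (insert e D) l x y (X ∪ {w}) Y ζ := by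
  have hB : clusterDelB ends (insert e D) ζ l = clusterDelB ends D ζ l := by
    unfold clusterDelB
    rw [closeOn_insert_of_eq_false (by simp [blue, he])]
  have hopen : closeOn ζ D e = true := by simp [closeOn, he, heD]
  by_cases hA : AvoidDel ends D ζ l X Y
  · have hC : clusterDel ends (insert e D) ζ l = clusterDel ends D ζ l :=
      cluster_closeOn_insert_eq hends hz hA.1
    have hzC : z ∉ clusterDel ends D ζ l := fun h => Set.disjoint_left.1 hA.1 h hz
    have hwC : w ∉ clusterDel ends D ζ l :=
      notMem_cluster_of_notMem_of_edge hends hopen hzC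
    have hA' : AvoidDel ends (insert e D) ζ l (X ∪ {w}) Y := by
      refine ⟨?_, hB ▸ hA.2⟩
      rw [hC, Set.disjoint_union_right]
      exact ⟨hA.1, Set.disjoint_singleton_right.2 hwC⟩
    unfold delTerm
    rw [if_pos hA, if_pos hA']
    unfold sideSignDel
    rw [hB, hC]
  · have hA' : ¬ AvoidDel ends (insert e D) ζ l (X ∪ {w}) Y := by
      intro hA'
      apply hA
      have hC : clusterDel ends D ζ l = clusterDel ends (insert e D) ζ l :=
        cluster_closeOn_eq_of_insert hends hz hA'.1
      refine ⟨?_, hB ▸ hA'.2⟩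
      rw [hC]
      exact Set.disjoint_of_subset_right Set.subset_union_left hA'.1
    unfold delTerm
    rw [if_neg hA, if_neg hA']

omit [Fintype E] in
/-- **Revealing a blue edge at a blue-avoided vertex**: for `ζ e = false`, `e = zw ∉ D`, `z ∈ Y`,
the summand equals the summand with `e` deleted and `w` blue-avoided. -/
lemma delTerm_of_eq_false (D : Finset E) (l x y : V) (X Y : Set V) (ζ : Config E) {e : E}
    {z w : V} (hends : ends e = s(z, w)) (hz : z ∈ Y) (heD : e ∉ D) (he : ζ e = false) :
    delTerm ends D l x y X Y ζ = delTerm ends (insert e D) l x y X (Y ∪ {w}) ζ := by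
  have he' : blue ζ e = true := by simp [blue, he]
  have := delTerm_of_eq_true (ends := ends) D l x y Y X (blue ζ) hends hz heD he'
  rw [delTerm_blue, delTerm_blue] at this
  exact this

omit [Fintype E] in
/-- Flipping the colour of `e` is an involution. -/
lemma flipEdge_involutive (e : E) :
    Function.Involutive (fun ζ : Config E => Function.update ζ e (!ζ e)) := by
  intro ζ
  simp

/-- The two halves of a sum of an `e`-inert function are equal. -/
lemma sum_ite_eq_sum_ite_not (g : Config E → ℤ) (e : E)
    (hg : ∀ ζ b, g (Function.update ζ e b) = g ζ) :
    (∑ ζ : Config E, if ζ e = true then g ζ else 0) =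
      ∑ ζ : Config E, if ζ e = true then 0 else g ζ := by
  rw [← (flipEdge_involutive (E := E) e).bijective.sum_comp
    (fun ζ => if ζ e = true then g ζ else 0)]
  refine Finset.sum_congr rfl fun ζ _ => ?_
  simp only [Function.update_self, hg, Bool.not_eq_true']
  by_cases h : ζ e = true <;> simp [h]

/-- `2 Σ (if ζ e then g else 0) = Σ g` for an `e`-inert `g`. -/
lemma two_mul_sum_ite (g : Config E → ℤ) (e : E)
    (hg : ∀ ζ b, g (Function.update ζ e b) = g ζ) :
    2 * (∑ ζ : Config E, if ζ e = true then g ζ else 0) = ∑ ζ : Config E, g ζ := by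
  have h := sum_ite_eq_sum_ite_not g e hg
  calc 2 * (∑ ζ : Config E, if ζ e = true then g ζ else 0)
      = (∑ ζ : Config E, if ζ e = true then g ζ else 0)
        + ∑ ζ : Config E, if ζ e = true then 0 else g ζ := by rw [two_mul, h]
    _ = ∑ ζ : Config E, g ζ := by
        rw [← Finset.sum_add_distrib]
        refine Finset.sum_congr rfl fun ζ _ => ?_
        by_cases hζ : ζ e = true <;> simp [hζ]

/-- `2 Σ (if ζ e then 0 else g) = Σ g` for an `e`-inert `g`. -/
lemma two_mul_sum_ite_not (g : Config E → ℤ) (e : E)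
    (hg : ∀ ζ b, g (Function.update ζ e b) = g ζ) :
    2 * (∑ ζ : Config E, if ζ e = true then 0 else g ζ) = ∑ ζ : Config E, g ζ := by
  rw [← sum_ite_eq_sum_ite_not g e hg]
  exact two_mul_sum_ite g e hg

/-- **The EDGE identity.** For `e = zw ∉ D` with `z ∈ X ∩ Y`:
`2 · A_D(X;Y) = A_{D ∪ e}(X ∪ {w}; Y) + A_{D ∪ e}(X; Y ∪ {w})`. -/
theorem two_mul_avoidSameSideDel (D : Finset E) (l x y : V) (X Y : Set V) {e : E} {z w : V}
    (hends : ends e = s(z, w)) (hzX : z ∈ X) (hzY : z ∈ Y) (heD : e ∉ D) :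
    2 * avoidSameSideDel ends D l x y X Y =
      avoidSameSideDel ends (insert e D) l x y (X ∪ {w}) Y
        + avoidSameSideDel ends (insert e D) l x y X (Y ∪ {w}) := by
  classical
  simp only [avoidSameSideDel_eq_sum]
  have hsplit : (∑ ζ : Config E, delTerm ends D l x y X Y ζ) =
      (∑ ζ : Config E, if ζ e = true then delTerm ends (insert e D) l x y (X ∪ {w}) Y ζ else 0)
      + ∑ ζ : Config E, if ζ e = true then 0 else delTerm ends (insert e D) l x y X (Y ∪ {w}) ζ := by
    rw [← Finset.sum_add_distrib]
    refine Finset.sum_congr rfl fun ζ _ => ?_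
    by_cases h : ζ e = true
    · simp only [h, if_true, add_zero]
      exact delTerm_of_eq_true D l x y X Y ζ hends hzX heD h
    · have h' : ζ e = false := by simpa using h
      simp only [h', Bool.false_eq_true, if_false, zero_add]
      exact delTerm_of_eq_false D l x y X Y ζ hends hzY heD h'
  rw [hsplit, mul_add,
    two_mul_sum_ite (delTerm ends (insert e D) l x y (X ∪ {w}) Y) e
      (fun ζ b => delTerm_update_insert D l x y (X ∪ {w}) Y ζ e b),
    two_mul_sum_ite_not (delTerm ends (insert e D) l x y X (Y ∪ {w})) e
      (fun ζ b => delTerm_update_insert D l x y X (Y ∪ {w}) ζ e b)]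

end Edge

end Hull

end Summit.Ventures.PercRepro2
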